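import Summits.NavierStokesRegularity.FluidComputer.RowCircuitTransfer
import Summits.NavierStokesRegularity.FluidComputer.RowChainTimeQ
import HarnessLib

/-!
# The exact circuit: WHEN the transfer happens — the physical arrival time `τ` satisfies
# `|τ − 0.95| ≤ 1/200` (`pub-fluidc-bp3/R1-DESIGN.md` §11.10)

HONEST FRAMING (cell `pub-fluidc`, blueprint seat bp3, gen 22): low prior, high value-of-information
experiment on Tao's machine paradigm; NOT a claim that NS blows up.

WHAT. The phase maps `s` of the chain are reference time ↦ physical time. Per row the certified
phase rate `|ṡ − 1| ≤ ρₖ` (fourth conjunct of `segAD`) integrates, by the one-sided mean value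
inequality on `s(t) − t` (`MemberOn.hsc/hsd`: continuity and right derivative), to
`|s(Tₖ₊₁) − s(Tₖ) − Hₖ| ≤ ρₖHₖ` (`row_time`); rows telescope within a stage (`seg_time`), the two
stage switches re-time by at most their windows (`StageOn.hσ`), so the arrival time
`τ = s_D(T₁₀₆₆)` obeys `|τ − σ₀ − (T₁₀₆₆ − T₀)| ≤ ∑ρₖHₖ + Ds₆₅₆/2^P + Ds₉₈₆/2^P` (`enclosure_timed`,
`chain_time`). With the certified budget `RowChain.time_budgetQ` this gives the timed one-scale
transfer `circuit_transfer_timed`: from `X0`, energy conserved, and at a physical time `τ` with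
`|τ − 19/20| ≤ 1/200` the next carrier holds `a₂(τ) ≥ 0.9636` under the caps `capQ`. No hypotheses.

[cite: Tao2016AveragedNS, §5.5 Thm 5.3 (5.5)]
-/

noncomputable section

namespace Summit.NavierStokesRegularity.FluidComputer

open Literature.Analysis.FluidPDE.FluidComputer

namespace RowChain

open RowCheck RowCheck.RowData RowRun ChainField Set

/-- **Per-row time**: `|s(Ts) − s(T₀) − (Ts − T₀)| ≤ ρ(Ts − T₀)` from the right-derivative bound.
[folklore] -/
theorem row_time {R : RowModel (Fin 8) (Fin 9)} {Ts : ℝ} (hm : R.MemberOn Ts) (hTs : R.T₀ ≤ Ts)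
    {ρ : ℝ} (hrate : ∀ t ∈ Ico R.T₀ Ts, |R.sd t - 1| ≤ ρ) :
    |R.s Ts - R.s R.T₀ - (Ts - R.T₀)| ≤ ρ * (Ts - R.T₀) := by
  have h := norm_image_sub_le_of_norm_deriv_right_le_segment (f := fun t => R.s t - t)
    (f' := fun t => R.sd t - 1) (hm.hsc.sub continuousOn_id)
    (fun t ht => (hm.hsd t ht).sub (hasDerivWithinAt_id _ _))
    (fun t ht => by rw [Real.norm_eq_abs]; exact hrate t ht) Ts ⟨hTs, le_rfl⟩
  rw [Real.norm_eq_abs] at h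
  calc |R.s Ts - R.s R.T₀ - (Ts - R.T₀)| = |R.s Ts - Ts - (R.s R.T₀ - R.T₀)| := by ring_nf
    _ ≤ ρ * (Ts - R.T₀) := h

/-- **Rows telescope**: per-row time slacks add up along one phase map. [folklore] -/
theorem seg_time (T H ρ : ℕ → ℝ) (hT : ∀ k, T (k + 1) = T k + H k) (s : ℝ → ℝ) (m n : ℕ)
    (hmn : m ≤ n) (h : ∀ k, m ≤ k → k < n → |s (T (k + 1)) - s (T k) - H k| ≤ ρ k * H k) :
    |s (T n) - s (T m) - (T n - T m)| ≤ ∑ k ∈ Finset.Ico m n, ρ k * H k := by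
  induction n, hmn using Nat.le_induction with
  | base => simp
  | succ n hmn ih =>
    have h1 := ih fun k hk hkn => h k hk (by omega)
    have h2 := h n hmn (by omega)
    rw [Finset.sum_Ico_succ_top hmn, hT n]
    calc |s (T n + H n) - s (T m) - (T n + H n - T m)|
        = |(s (T n) - s (T m) - (T n - T m)) + (s (T n + H n) - s (T n) - H n)| := by ring_nf
      _ ≤ |s (T n) - s (T m) - (T n - T m)| + |s (T n + H n) - s (T n) - H n| := abs_add_le _ _
      _ ≤ _ := by rw [hT n] at h2; exact add_le_add h1 h2

/-- **The chain's clock**: three stages and two switch re-timings. [folklore] -/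
theorem chain_time (T H ρ : ℕ → ℝ) (hT : ∀ k, T (k + 1) = T k + H k) (sA sB sD : ℝ → ℝ)
    {σ₀ O₁ O₂ : ℝ} (hs0 : sA (T 0) = σ₀)
    (hA : ∀ k < 657, |sA (T (k + 1)) - sA (T k) - H k| ≤ ρ k * H k)
    (hB : ∀ k, 657 ≤ k → k < 987 → |sB (T (k + 1)) - sB (T k) - H k| ≤ ρ k * H k)
    (hD : ∀ k, 987 ≤ k → k < 1066 → |sD (T (k + 1)) - sD (T k) - H k| ≤ ρ k * H k)
    (o₁ : |sB (T 657) - sA (T 657)| ≤ O₁) (o₂ : |sD (T 987) - sB (T 987)| ≤ O₂) :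
    |sD (T 1066) - σ₀ - (T 1066 - T 0)| ≤ ∑ k ∈ Finset.range 1066, ρ k * H k + O₁ + O₂ := by
  have eA := seg_time T H ρ hT sA 0 657 (by norm_num) fun k _ hk => hA k hk
  have eB := seg_time T H ρ hT sB 657 987 (by norm_num) hB
  have eD := seg_time T H ρ hT sD 987 1066 (by norm_num) hD
  have hsum : ∑ k ∈ Finset.range 1066, ρ k * H k = ∑ k ∈ Finset.Ico 0 657, ρ k * H k +
      ∑ k ∈ Finset.Ico 657 987, ρ k * H k + ∑ k ∈ Finset.Ico 987 1066, ρ k * H k := by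
    rw [Finset.range_eq_Ico, Finset.sum_Ico_consecutive _ (by norm_num) (by norm_num),
      Finset.sum_Ico_consecutive _ (by norm_num) (by norm_num)]
  rw [hsum, ← hs0]
  calc |sD (T 1066) - sA (T 0) - (T 1066 - T 0)|
      = |(sD (T 1066) - sD (T 987) - (T 1066 - T 987)) + (sD (T 987) - sB (T 987)) +
          (sB (T 987) - sB (T 657) - (T 987 - T 657)) + (sB (T 657) - sA (T 657)) +
          (sA (T 657) - sA (T 0) - (T 657 - T 0))| := by ring_nf
    _ ≤ |sD (T 1066) - sD (T 987) - (T 1066 - T 987)| + |sD (T 987) - sB (T 987)| +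
          |sB (T 987) - sB (T 657) - (T 987 - T 657)| + |sB (T 657) - sA (T 657)| +
          |sA (T 657) - sA (T 0) - (T 657 - T 0)| := by
        refine (abs_add_le _ _).trans (add_le_add ((abs_add_le _ _).trans (add_le_add
          ((abs_add_le _ _).trans (add_le_add ((abs_add_le _ _).trans le_rfl) le_rfl)) le_rfl))
          le_rfl)
    _ ≤ _ := by linarith

/-- **Layers A + A′ with the clock**: `enclosure` plus, for the same phase maps, the per-row time
slacks and the two switch re-timing offsets. [folklore] -/
theorem enclosure_timed (T : ℕ → ℝ) (hT : ∀ k, T (k + 1) = T k + (row k).Hq)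
    {y δF : ℝ → Fin 9 → ℝ} {D : Set ℝ} (hDo : IsOpen D)
    (hy : ∀ σ ∈ D, ∀ a, HasDerivAt (fun τ => y τ a) (F gK ΛK (y σ) a + δF σ a) σ)
    (hFc : ∀ k < 1066, ContinuousOn (fun σ => F gK ΛK (y σ) (row k).p + δF σ (row k).p) D)
    (htube : ∀ k < 1066, ∀ σ ∈ D, ∀ t ∈ Icc (T k) (T (k + 1)),
      (∀ a, |y σ a - xh (row k).CQ (t - T k) a| ≤ (row k).EbarR a) →
        ∀ a, |δF σ a| ≤ (row k).δR a)
    (hDmax : ∀ K ⊆ D, (∀ a, ∃ C, ∀ σ ∈ K, |y σ a| ≤ C) → closure K ⊆ D)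
    (hW1 : ∀ σ ∈ D, (∀ a, |y σ a - (row 657).X0R a| ≤ ((row 656).Eb a : ℝ) / 2 ^ (row 657).P) →
      Icc (σ - (cert656.Ds : ℝ) / 2 ^ (row 657).P) (σ + (cert656.Ds : ℝ) / 2 ^ (row 657).P) ⊆ D ∧
      ∀ ξ ∈ Icc (σ - (cert656.Ds : ℝ) / 2 ^ (row 657).P) (σ + (cert656.Ds : ℝ) / 2 ^ (row 657).P),
        ∀ a, |δF ξ a| ≤ ((max ((row 656).DEL a) ((row 657).DEL a) : ℤ) : ℝ) / 2 ^ (row 657).P)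
    (hW2 : ∀ σ ∈ D, (∀ a, |y σ a - (row 987).X0R a| ≤ ((row 986).Eb a : ℝ) / 2 ^ (row 987).P) →
      Icc (σ - (cert986.Ds : ℝ) / 2 ^ (row 987).P) (σ + (cert986.Ds : ℝ) / 2 ^ (row 987).P) ⊆ D ∧
      ∀ ξ ∈ Icc (σ - (cert986.Ds : ℝ) / 2 ^ (row 987).P) (σ + (cert986.Ds : ℝ) / 2 ^ (row 987).P),
        ∀ a, |δF ξ a| ≤ ((max ((row 986).DEL a) ((row 987).DEL a) : ℤ) : ℝ) / 2 ^ (row 987).P)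
    {σ₀ : ℝ} (hσ₀ : σ₀ ∈ D) (hlock0 : y σ₀ (row 0).p = xh (row 0).CQ 0 (row 0).p)
    (hu0 : ∀ i, |(toModel (canon (framesOK_row 0)) (G 0) (T 0)
      ⟨y, δF, D, fun _ => σ₀, fun _ => 0⟩).z (T 0) i| ≤ (row 0).ubR 0 i) :
    ∃ sA sdA sB sdB sD sdD : ℝ → ℝ, sA (T 0) = σ₀ ∧ (∀ k < 1066,
      (∀ i, |(toModel (canon (framesOK_row k)) (G k) (T k)
        (mOf ⟨y, δF, D, sA, sdA⟩ ⟨y, δF, D, sB, sdB⟩ ⟨y, δF, D, sD, sdD⟩ k)).z (T k) i| ≤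
          (row k).ubR 0 i) ∧
      (∀ t ∈ Icc (T k) (T (k + 1)), ∀ a, |(toModel (canon (framesOK_row k)) (G k) (T k)
        (mOf ⟨y, δF, D, sA, sdA⟩ ⟨y, δF, D, sB, sdB⟩ ⟨y, δF, D, sD, sdD⟩ k)).e t a| ≤
          (row k).EbarR a) ∧
      (∀ t ∈ Icc (T k) (T (k + 1)), ∀ i, |(toModel (canon (framesOK_row k)) (G k) (T k)
        (mOf ⟨y, δF, D, sA, sdA⟩ ⟨y, δF, D, sB, sdB⟩ ⟨y, δF, D, sD, sdD⟩ k)).z t i| ≤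
          (row k).WbarR i) ∧
      (∀ t ∈ Ico (T k) (T (k + 1)),
        |(mOf ⟨y, δF, D, sA, sdA⟩ ⟨y, δF, D, sB, sdB⟩ ⟨y, δF, D, sD, sdD⟩ k).sd t - 1| ≤
          (row k).rhoR)) ∧
    (∀ k < 1066, |(mOf ⟨y, δF, D, sA, sdA⟩ ⟨y, δF, D, sB, sdB⟩ ⟨y, δF, D, sD, sdD⟩ k).s
        (T (k + 1)) - (mOf ⟨y, δF, D, sA, sdA⟩ ⟨y, δF, D, sB, sdB⟩ ⟨y, δF, D, sD, sdD⟩ k).s (T k)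
        - (row k).Hq| ≤ (row k).rhoR * (row k).Hq) ∧
    |sB (T 657) - sA (T 657)| ≤ (cert656.Ds : ℝ) / 2 ^ (row 657).P ∧
    |sD (T 987) - sB (T 987)| ≤ (cert986.Ds : ℝ) / 2 ^ (row 987).P := by
  obtain ⟨sA, sdA, sB, sdB, sD, sdD, hsA0, hmem, ⟨S1⟩, ⟨S2⟩⟩ := chain_members T hT hDo hy hFc htube
    hDmax hW1 hW2 hσ₀ hlock0 hu0
  have hu0A : ∀ i, |(toModel (canon (framesOK_row 0)) (G 0) (T 0) ⟨y, δF, D, sA, sdA⟩).z (T 0) i|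
      ≤ (row 0).ubR 0 i := by
    intro i
    rw [z_start_eq _ _ _ y δF D (s' := fun _ => σ₀) (sd' := fun _ => 0) hsA0]
    exact hu0 i
  have h := segAD T hT ⟨y, δF, D, sA, sdA⟩ ⟨y, δF, D, sB, sdB⟩ ⟨y, δF, D, sD, sdD⟩
    (fun k hk => (hmem k hk).some) hu0A S1 S2
  refine ⟨sA, sdA, sB, sdB, sD, sdD, hsA0, h, fun k hk => ?_, S1.hσ, S2.hσ⟩
  have hH : T (k + 1) - T k = (row k).Hq := by rw [hT k]; ring
  have hle : T k ≤ T (k + 1) := by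
    have := Hq_pos ((runOK_iff _).mp (runOK_row k)).1
    linarith
  have h1 := row_time (hmem k hk).some hle (h k hk).2.2.2
  change |(mOf _ _ _ k).s (T (k + 1)) - (mOf _ _ _ k).s (T k) - (T (k + 1) - T k)| ≤
    (row k).rhoR * (T (k + 1) - T k) at h1
  rw [hH] at h1
  exact h1

/-- **The exact circuit, timed**: from any admissible start, at a physical time `τ` within
`∑ρₖHₖ + Ds₆₅₆/2^P + Ds₉₈₆/2^P` of the reference horizon `Tc 1066`, the state is within `Ē₁₀₆₅` of
`XEND`. [folklore] -/
theorem circuit_timed_from (q₀ : Fin 9 → ℝ) (hlock : q₀ (row 0).p = X0 (row 0).p)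
    (hbox : ∀ i, |z0 q₀ i| ≤ (row 0).ubR 0 i) :
    ∃ y : ℝ → Fin 9 → ℝ, y 0 = q₀ ∧ (∀ σ, HasDerivAt y (F gK ΛK (y σ)) σ) ∧ ∃ τ : ℝ,
      |τ - Tc 1066| ≤ ∑ k ∈ Finset.range 1066, (row k).rhoR * (row k).Hq +
        (cert656.Ds : ℝ) / 2 ^ (row 657).P + (cert986.Ds : ℝ) / 2 ^ (row 987).P ∧
      ∀ a, |y τ a - XEND a| ≤ (row 1065).EbarR a := by
  obtain ⟨y, hy0, hsol⟩ := CircuitFlow.circuit_solution gK ΛK q₀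
  have hyc : Continuous y := continuous_iff_continuousAt.2 fun σ => (hsol σ).continuousAt
  have hwin : ∀ (k k' : ℕ) (a : Fin 9), |(0 : ℝ → Fin 9 → ℝ) 0 a| ≤
      ((max ((row k).DEL a) ((row k').DEL a) : ℤ) : ℝ) / 2 ^ (row k').P :=
    fun k k' a => by
    rw [Pi.zero_apply, Pi.zero_apply, abs_zero]
    exact div_nonneg (by exact_mod_cast (DEL_nonneg_row k a).trans (le_max_left _ _))
      (by positivity)
  obtain ⟨sA, sdA, sB, sdB, sD, sdD, hs0, h, hrow, o₁, o₂⟩ := enclosure_timed Tc Tc_succ (y := y)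
    (δF := 0) (D := univ) isOpen_univ
    (fun σ _ a => by simpa using (hasDerivAt_pi.1 (hsol σ)) a)
    (fun k _ => by
      have hc : Continuous fun σ => F gK ΛK (y σ) (row k).p :=
        (continuous_apply (row k).p).comp ((continuous_F gK ΛK).comp hyc)
      simpa using hc)
    (fun k _ σ _ t _ _ a => by simpa using δR_nonneg_row k a)
    (fun K _ _ => subset_univ _)
    (fun σ _ _ => ⟨subset_univ _, fun ξ _ a => hwin 656 657 a⟩)
    (fun σ _ _ => ⟨subset_univ _, fun ξ _ a => hwin 986 987 a⟩)
    (σ₀ := 0) (mem_univ _) (by rw [hy0, hlock]; rfl)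
    (fun i => by
      rw [z_start_eq_z0 (Tc 0) y 0 univ (fun _ => 0) (fun _ => 0) rfl hy0]
      exact hbox i)
  refine ⟨y, hy0, hsol, sD (Tc 1066), ?_, fun a => ?_⟩
  · have hc := chain_time Tc (fun k => ((row k).Hq : ℝ)) (fun k => (row k).rhoR) Tc_succ sA sB sD
      hs0 (fun k hk => by have := hrow k (by omega); rwa [mOf_A hk] at this)
      (fun k hk hk' => by have := hrow k (by omega); rwa [mOf_B hk hk'] at this)
      (fun k hk hk' => by have := hrow k hk'; rwa [mOf_D hk] at this) o₁ o₂
    rw [Tc_zero] at hc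
    simpa using hc
  · obtain ⟨-, htube, -, -⟩ := h 1065 (by norm_num)
    have ht : Tc 1066 ∈ Icc (Tc 1065) (Tc (1065 + 1)) := by
      refine ⟨?_, le_rfl⟩
      rw [show Tc 1066 = Tc 1065 + (row 1065).Hq from Tc_succ 1065]
      have hH : (0 : ℝ) < (row 1065).Hq := Hq_pos ((runOK_iff _).mp (runOK_row 1065)).1
      linarith
    have h1 := htube (Tc 1066) ht a
    rw [mOf_D (by norm_num)] at h1
    have hH : Tc 1066 - Tc 1065 = (row 1065).Hq := by
      rw [show Tc 1066 = Tc 1065 + (row 1065).Hq from Tc_succ 1065]; ring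
    have he : (toModel (canon (framesOK_row 1065)) (G 1065) (Tc 1065) ⟨y, 0, univ, sD, sdD⟩).e
        (Tc 1066) a = y (sD (Tc 1066)) a - XEND a := by
      show y (sD (Tc 1066)) a - xh (row 1065).CQ (Tc 1066 - Tc 1065) a = _
      rw [hH]
      rfl
    rw [he] at h1
    exact h1

/-- The time budget in `ℝ`. [folklore] -/
theorem time_budget :
    ∑ k ∈ Finset.range 1066, (row k).rhoR * (row k).Hq +
        (cert656.Ds : ℝ) / 2 ^ (row 657).P + (cert986.Ds : ℝ) / 2 ^ (row 987).P ≤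
      1 / 600 + 1 / 700 ∧ |Tc 1066 - 19 / 20| ≤ (1 : ℝ) / 1000 := by
  obtain ⟨h1, h2, h3⟩ := time_budgetQ
  have h1' : ((∑ k ∈ Finset.range 1066, ((row k).ph'.rho : ℚ) / 2 ^ (row k).P * (row k).Hq : ℚ)
      : ℝ) ≤ ((1 / 600 : ℚ) : ℝ) := by exact_mod_cast h1
  have h2' : (((cert656.Ds : ℚ) / 2 ^ (row 657).P + (cert986.Ds : ℚ) / 2 ^ (row 987).P : ℚ) : ℝ)
      ≤ ((1 / 700 : ℚ) : ℝ) := by exact_mod_cast h2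
  have h3' : ((|∑ k ∈ Finset.range 1066, (row k).Hq - 19 / 20| : ℚ) : ℝ) ≤ ((1 / 1000 : ℚ) : ℝ) :=
    by exact_mod_cast h3
  push_cast at h1' h2' h3'
  refine ⟨?_, ?_⟩
  · have : ∑ k ∈ Finset.range 1066, (row k).rhoR * (row k).Hq =
        ∑ k ∈ Finset.range 1066, ((row k).ph'.rho : ℝ) / 2 ^ (row k).P * (row k).Hq := rfl
    rw [this]
    linarith
  · have : Tc 1066 = ∑ k ∈ Finset.range 1066, ((row k).Hq : ℝ) := rfl
    rw [this]
    exact h3'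

/-- **The timed one-scale transfer (`I(n) ⇒ I(n+1)` for the exact circuit, with its clock).**
From the designed state `X0` (`a₁(0) ≥ 0.9961`, energy `≤ 1`) the circuit conserves energy and
at a PHYSICAL time `τ` with `|τ − 19/20| ≤ 1/200` the next carrier holds `a₂(τ) ≥ 0.9636` while
every coordinate is capped by `capQ`. No hypotheses. [folklore] -/
theorem circuit_transfer_timed :
    (9961 : ℝ) / 10000 ≤ X0 0 ∧ ∑ a, X0 a ^ 2 ≤ 1 ∧
    ∃ y : ℝ → Fin 9 → ℝ, y 0 = X0 ∧ (∀ σ, HasDerivAt y (F gK ΛK (y σ)) σ) ∧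
      (∀ τ, ∑ a, y τ a ^ 2 = ∑ a, X0 a ^ 2) ∧
      ∃ τ : ℝ, |τ - 19 / 20| ≤ 1 / 200 ∧ (2409 : ℝ) / 2500 ≤ y τ 4 ∧
        ∀ a, |y τ a| ≤ (capQ a : ℝ) := by
  refine ⟨start_readout.2.1, start_readout.2.2, ?_⟩
  obtain ⟨y, hy0, hsol, τ, hτ, hend⟩ := circuit_timed_from X0 rfl fun i => by
    rw [z0_X0, abs_zero]; exact ubR_zero_nonneg_row 0 i
  obtain ⟨hb, hT⟩ := time_budget
  refine ⟨y, hy0, hsol, fun τ => hy0 ▸ energy_conserved hsol τ, τ, ?_, end_readout (y τ) hend⟩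
  have h1 : |τ - Tc 1066| ≤ 1 / 600 + 1 / 700 := hτ.trans hb
  calc |τ - 19 / 20| = |(τ - Tc 1066) + (Tc 1066 - 19 / 20)| := by ring_nf
    _ ≤ |τ - Tc 1066| + |Tc 1066 - 19 / 20| := abs_add_le _ _
    _ ≤ 1 / 200 := by linarith

end RowChain

end Summit.NavierStokesRegularity.FluidComputer
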